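import Summits.CriticalPhenomena.CardyFormulaZ2.Theorems.CardyUniqueLimitCardyRigidityConformalKit3
import Literature.Probability.RandomPlanarGeometry.LoewnerDrivingModulus
import HarnessLib

/-!
# Conformal kit (K1b/K2 for the Loewner maps): the instantiation at `g_t : ℍ ∖ K_t → ℍ`

Crux `Summit.CriticalPhenomena.CardyFormulaZ2.Theses.CardyUniqueLimit.CardyRigidity`
(stmt-CriticalPhenomena-0746), line `crossing_martingale`, helper kit for the heart
`stub_slitObservableApprox`.  The kit of `…ConformalKit.lean` (K1: Wolff, short sets reaching the
boundary), `…ConformalKit2.lean`/`…ConformalKit3.lean` (K2: uniform local connectedness ⇒ uniform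
boundary modulus; K3: Koebe) is stated for an abstract conformal bijection `g : U → ℍ` with
continuous inverse `f` and displacement bound `C₀`.  Here it is read at the chordal Loewner maps
`g_t = Loewner.map W t` on `H_t = Loewner.domain W t = ℍ ∖ K_t`, `f_t = Loewner.loewnerInv W t`,
for a CONTINUOUS driving function `W` and a hull `K_t ∩ ℍ ⊆ B̄(x₀, R)` (`x₀` real, `R > 0`), whose
displacement bound is `C₀ = 580 R` (Lawler (2005), (3.12); the tree's
`IsHydrodynamicMap.norm_sub_self_le`):

* `loewner_norm_map_sub_self_le` — `‖g_t z - z‖ ≤ 580 R` on `H_t` (and for `f_t` on `ℍ`);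
* `loewner_norm_map_sub_map_le` — **Wolff**: a preconnected `Q ⊆ H_t ∩ B(p, d)`, `0 < d < 1`, has
  `‖g_t z₁ - g_t z₂‖ ≤ 8π (1 + 580 R)/√(log (1/d))` on `Q` (the tree's
  `LengthArea.norm_sub_le_of_isPreconnected`; cf. `IsGeneratedByCurve.norm_map_sub_map_le_of_ball`
  for curve pieces);
* `loewner_exists_real_forall_dist_map_le`, `loewner_im_map_le_of_dist_lt` — (K1b) at `g_t`:
  if moreover the closure of `Q` meets `K_t ∪ (ℂ ∖ ℍ)`, then `g_t(Q)` lies in that disc about a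
  REAL point; and `im g_t(q) ≤ 8π (1 + 580 R)/√(log (1/d))` whenever `dist q (ℂ ∖ H_t) < d`;
* `loewner_exists_forall_dist_loewnerInv_le_of_hlc` — (K2) at `f_t`: uniform local
  connectedness of `ℂ ∖ H_t` at scale `(ε₁, η)` near the real point `x` and the Wolff scale
  `d(580 R, ε₁, η)` give `f_t(ℍ ∩ B(x, d)) ⊆ B̄(a, η)` for some `a ∈ ∂H_t`.

References: G. F. Lawler, *Conformally Invariant Processes in the Plane* (2005), §3.4 (3.12),
§4.1 [Lawler2005]; Ch. Pommerenke (1992), Prop. 2.2, Prop. 2.3 [PommerenkeBBCM1992].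
-/

noncomputable section

open Set Filter Metric MeasureTheory Real
open _root_.Complex _root_.Topology
open UpperHalfPlane (upperHalfPlaneSet isOpen_upperHalfPlaneSet)
open scoped ENNReal NNReal
open Literature.Probability.RandomPlanarGeometry
open Literature.Probability.RandomPlanarGeometry.Loewner

namespace Summit.CriticalPhenomena.CardyFormulaZ2.Cruxes.CardyRigidity.CrossingMartingale

namespace ConformalKit

variable {W : ℝ≥0 → ℝ} {t : ℝ≥0} {x₀ R : ℝ}

/-- **`‖g_t z - z‖ ≤ 580 R` on `H_t`** when `K_t ∩ ℍ ⊆ B̄(x₀, R)` (Lawler (2005), (3.12), through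
the tree's `IsHydrodynamicMap.norm_sub_self_le` and `isHydrodynamicMap_of_eqOn`).
[cite: Lawler2005, §3.4 (3.12)] -/
theorem loewner_norm_map_sub_self_le (hW : Continuous W)
    (hK : hull W t ∩ upperHalfPlaneSet ⊆ closedBall (x₀ : ℂ) R) (hR : 0 < R) {z : ℂ}
    (hz : z ∈ domain W t) : ‖map W t z - z‖ ≤ 580 * R := by
  -- adapted from `IsGeneratedByCurve.norm_map_sub_map_le_of_ball`
  obtain ⟨φ, hφ⟩ := exists_conformalEquiv_map_holds hW t
  have hH := isHydrodynamicMap_of_eqOn hW t hφ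
  have h1 := hH.norm_sub_self_le hK hR hz
  rwa [hφ hz] at h1

/-- `‖f_t w - w‖ ≤ 580 R` on `ℍ` for the inverse Loewner map. [cite: Lawler2005, §3.4 (3.12)] -/
theorem loewner_norm_loewnerInv_sub_self_le (hW : Continuous W)
    (hK : hull W t ∩ upperHalfPlaneSet ⊆ closedBall (x₀ : ℂ) R) (hR : 0 < R) {w : ℂ}
    (hw : w ∈ upperHalfPlaneSet) : ‖loewnerInv W t w - w‖ ≤ 580 * R :=
  Literature.Analysis.Complex.LengthArea.norm_inverse_sub_le
    (fun _ hz ↦ loewnerInv_mem_domain hW t hz) (fun _ hw ↦ map_loewnerInv hW t hw)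
    (fun _ hz ↦ loewner_norm_map_sub_self_le hW hK hR hz) hw

/-- **Wolff's lemma for `g_t` on an arbitrary small preconnected set**: for `Q ⊆ H_t ∩ B(p, d)`
preconnected, `0 < d < 1`, and `K_t ∩ ℍ ⊆ B̄(x₀, R)`:
`‖g_t z₁ - g_t z₂‖ ≤ 8π (1 + 580 R)/√(log (1/d))` for `z₁, z₂ ∈ Q`.
[cite: PommerenkeBBCM1992, Prop. 2.2] -/
theorem loewner_norm_map_sub_map_le (hW : Continuous W)
    (hK : hull W t ∩ upperHalfPlaneSet ⊆ closedBall (x₀ : ℂ) R) (hR : 0 < R) {d : ℝ}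
    (hd : 0 < d) (hd1 : d < 1) {Q : Set ℂ} {p : ℂ} (hQ : IsPreconnected Q) (hQU : Q ⊆ domain W t)
    (hQd : Q ⊆ ball p d) {z₁ z₂ : ℂ} (hz₁ : z₁ ∈ Q) (hz₂ : z₂ ∈ Q) :
    ‖map W t z₁ - map W t z₂‖ ≤ 8 * π * (1 + 580 * R) / √(Real.log (1 / d)) :=
  Literature.Analysis.Complex.LengthArea.norm_sub_le_of_isPreconnected (isOpen_domain hW t)
    (differentiableOn_map hW t) (mapsTo_map hW t) (f := loewnerInv W t)
    (fun _ hz ↦ loewnerInv_mem_domain hW t hz) (differentiableOn_invFunOn_map hW t).continuousOn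
    (fun _ hw ↦ map_loewnerInv hW t hw) (fun _ hz ↦ loewnerInv_map hW hz)
    (fun _ hz ↦ loewner_norm_map_sub_self_le hW hK hR hz) hd hd1 hQ hQU hQd hz₁ hz₂

/-- **(K1b) at `g_t`: small connected sets reaching `K_t ∪ ℝ` are mapped next to a real point.**
For `Q ⊆ H_t ∩ B(p, d)` preconnected (`0 < d < 1`) whose closure contains a point `b ∉ H_t`:
`g_t(Q) ⊆ B̄(x, 8π (1 + 580 R)/√(log (1/d)))` for some real `x`. [cite: PommerenkeBBCM1992, Prop. 2.2] -/
theorem loewner_exists_real_forall_dist_map_le (hW : Continuous W)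
    (hK : hull W t ∩ upperHalfPlaneSet ⊆ closedBall (x₀ : ℂ) R) (hR : 0 < R) {d : ℝ}
    (hd : 0 < d) (hd1 : d < 1) {Q : Set ℂ} {p : ℂ} (hQ : IsPreconnected Q) (hQU : Q ⊆ domain W t)
    (hQd : Q ⊆ ball p d) {b : ℂ} (hbQ : b ∈ closure Q) (hbU : b ∉ domain W t) :
    ∃ x : ℝ, ∀ z ∈ Q, dist (map W t z) x ≤ 8 * π * (1 + 580 * R) / √(Real.log (1 / d)) :=
  exists_real_forall_dist_le_of_closure (isOpen_domain hW t) (differentiableOn_map hW t)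
    (mapsTo_map hW t) (f := loewnerInv W t) (fun _ hz ↦ loewnerInv_mem_domain hW t hz)
    (differentiableOn_invFunOn_map hW t).continuousOn (fun _ hw ↦ map_loewnerInv hW t hw)
    (fun _ hz ↦ loewnerInv_map hW hz) (fun _ hz ↦ loewner_norm_map_sub_self_le hW hK hR hz)
    hd hd1 hQ hQU hQd hbQ hbU

/-- **(K1b) at `g_t`, pointwise: `im g_t` is uniformly small near `K_t ∪ ℝ`.** If
`K_t ∩ ℍ ⊆ B̄(x₀, R)`, `q ∈ H_t`, `b ∉ H_t` and `dist q b < d < 1`, then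
`im g_t(q) ≤ 8π (1 + 580 R)/√(log (1/d))`. [cite: PommerenkeBBCM1992, Prop. 2.2] -/
theorem loewner_im_map_le_of_dist_lt (hW : Continuous W)
    (hK : hull W t ∩ upperHalfPlaneSet ⊆ closedBall (x₀ : ℂ) R) (hR : 0 < R) {d : ℝ}
    (hd : 0 < d) (hd1 : d < 1) {q b : ℂ} (hq : q ∈ domain W t) (hb : b ∉ domain W t)
    (hqb : dist q b < d) :
    (map W t q).im ≤ 8 * π * (1 + 580 * R) / √(Real.log (1 / d)) :=
  im_le_of_dist_lt (isOpen_domain hW t) (differentiableOn_map hW t) (mapsTo_map hW t)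
    (f := loewnerInv W t) (fun _ hz ↦ loewnerInv_mem_domain hW t hz)
    (differentiableOn_invFunOn_map hW t).continuousOn (fun _ hw ↦ map_loewnerInv hW t hw)
    (fun _ hz ↦ loewnerInv_map hW hz) (fun _ hz ↦ loewner_norm_map_sub_self_le hW hK hR hz)
    hd hd1 hq hb hqb

/-- **(K2) at `f_t = g_t⁻¹`: uniform local connectedness of `ℂ ∖ H_t` near `x` ⇒ the near side
`f_t(ℍ ∩ B(x, d))` is small.**  If `K_t ∩ ℍ ⊆ B̄(x₀, R)`, `ℂ ∖ H_t` is uniformly locally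
connected at scale `(ε₁, η)` for boundary points in `V ⊇ B̄(x, 1 + 580 R)` (`x` real), and
`0 < d < 1` has Wolff bound `4π (1 + 580 R)/√(log (1/d)) < ε₁`, `≤ η`
(`exists_scale_lt_le`), then `f_t(ℍ ∩ B(x, d)) ⊆ B̄(a, η)` for some `a ∈ ∂H_t`.
[cite: PommerenkeBBCM1992, Prop. 2.3] -/
theorem loewner_exists_forall_dist_loewnerInv_le_of_hlc (hW : Continuous W)
    (hK : hull W t ∩ upperHalfPlaneSet ⊆ closedBall (x₀ : ℂ) R) (hR : 0 < R) {V : Set ℂ}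
    {ε₁ η : ℝ}
    (hlc : ∀ a ∈ frontier (domain W t), ∀ b ∈ frontier (domain W t), a ∈ V → b ∈ V →
      dist a b < ε₁ → ∃ σ ⊆ (domain W t)ᶜ, IsCompact σ ∧ IsPreconnected σ ∧ a ∈ σ ∧ b ∈ σ ∧
        σ ⊆ closedBall a η)
    {d : ℝ} (hd : 0 < d) (hd1 : d < 1)
    (hε₁ : 4 * π * (1 + 580 * R) / √(Real.log (1 / d)) < ε₁)
    (hη : 4 * π * (1 + 580 * R) / √(Real.log (1 / d)) ≤ η) {x : ℝ}
    (hV : closedBall (x : ℂ) (1 + 580 * R) ⊆ V) :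
    ∃ a ∈ frontier (domain W t), ∀ w ∈ upperHalfPlaneSet, dist w x < d →
      dist (loewnerInv W t w) a ≤ η :=
  exists_forall_dist_le_of_hlc (differentiableOn_invFunOn_map hW t) (isOpen_domain hW t)
    (fun _ hz ↦ loewnerInv_mem_domain hW t hz) (differentiableOn_map hW t).continuousOn
    (mapsTo_map hW t) (fun _ hw ↦ map_loewnerInv hW t hw) (fun _ hz ↦ loewnerInv_map hW hz)
    (by positivity) (fun _ hw ↦ loewner_norm_loewnerInv_sub_self_le hW hK hR hw) hlc hd hd1 hε₁
    hη hV

/-- **(K2) at `f_t`, modulus form on `ℍ ∩ B̄(0, X)`**: with ULC of `ℂ ∖ H_t` at scale `(ε₁, η)`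
for boundary points in `B̄(0, X + 1 + 580 R)` and the Wolff scale `d`, all `w, w' ∈ ℍ` with
`‖w‖ ≤ X`, `dist w w' ≤ min (d/4) (η d/(d + 8 · 580 R))` have `dist (f_t w) (f_t w') ≤ 2η`.
[cite: PommerenkeBBCM1992, Prop. 2.3] -/
theorem loewner_dist_loewnerInv_le_of_hlc (hW : Continuous W)
    (hK : hull W t ∩ upperHalfPlaneSet ⊆ closedBall (x₀ : ℂ) R) (hR : 0 < R) {X ε₁ η : ℝ}
    (hη0 : 0 ≤ η)
    (hlc : ∀ a ∈ frontier (domain W t), ∀ b ∈ frontier (domain W t),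
      a ∈ closedBall (0 : ℂ) (X + 1 + 580 * R) → b ∈ closedBall (0 : ℂ) (X + 1 + 580 * R) →
      dist a b < ε₁ → ∃ σ ⊆ (domain W t)ᶜ, IsCompact σ ∧ IsPreconnected σ ∧ a ∈ σ ∧ b ∈ σ ∧
        σ ⊆ closedBall a η)
    {d : ℝ} (hd : 0 < d) (hd1 : d < 1)
    (hε₁ : 4 * π * (1 + 580 * R) / √(Real.log (1 / d)) < ε₁)
    (hηd : 4 * π * (1 + 580 * R) / √(Real.log (1 / d)) ≤ η) {w w' : ℂ}
    (hw : w ∈ upperHalfPlaneSet) (hw' : w' ∈ upperHalfPlaneSet) (hwX : ‖w‖ ≤ X)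
    (hdist : dist w w' ≤ min (d / 4) (η * d / (d + 8 * (580 * R)))) :
    dist (loewnerInv W t w) (loewnerInv W t w') ≤ 2 * η :=
  dist_le_of_hlc_of_dist_le (differentiableOn_invFunOn_map hW t) (isOpen_domain hW t)
    (fun _ hz ↦ loewnerInv_mem_domain hW t hz) (differentiableOn_map hW t).continuousOn
    (mapsTo_map hW t) (fun _ hw ↦ map_loewnerInv hW t hw) (fun _ hz ↦ loewnerInv_map hW hz)
    (by positivity) (fun _ hw ↦ loewner_norm_loewnerInv_sub_self_le hW hK hR hw) hη0 hlc hd hd1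
    hε₁ hηd hw hw' hwX hdist

end ConformalKit

/-- **Registered form** (anchor `conformalKit_loewner_im_map_le_of_dist_lt` of stmt-CriticalPhenomena-0746, (K1b) at the
Loewner maps): for a continuous driving function `W` with hull `K_t ∩ ℍ ⊆ B̄(x₀, R)` (`R > 0`), every `q ∈ H_t` within
distance `d < 1` of a point off `H_t` has `im g_t(q) ≤ 8π (1 + 580 R)/√(log (1/d))`. [cite: PommerenkeBBCM1992, Prop. 2.2] -/
theorem conformalKit_loewner_im_map_le_of_dist_lt : ∀ (W : NNReal → ℝ) (t : NNReal) (x₀ R d : ℝ) (q b : ℂ), Continuous W → Literature.Probability.RandomPlanarGeometry.Loewner.hull W t ∩ UpperHalfPlane.upperHalfPlaneSet ⊆ Metric.closedBall (x₀ : ℂ) R → 0 < R → 0 < d → d < 1 → q ∈ Literature.Probability.RandomPlanarGeometry.Loewner.domain W t → b ∉ Literature.Probability.RandomPlanarGeometry.Loewner.domain W t → dist q b < d → (Literature.Probability.RandomPlanarGeometry.Loewner.map W t q).im ≤ 8 * Real.pi * (1 + 580 * R) / Real.sqrt (Real.log (1 / d)) :=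
  fun _ _ _ _ _ _ _ hW hK hR hd hd1 hq hb hqb ↦
    ConformalKit.loewner_im_map_le_of_dist_lt hW hK hR hd hd1 hq hb hqb

end Summit.CriticalPhenomena.CardyFormulaZ2.Cruxes.CardyRigidity.CrossingMartingale
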